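/-
Copyright (c) 2026 the pub-hodgecm-mathlib formalisation cell (harness21).  Prover seat hodgecm-mathlib-K2E1-p15 (g2), Track B ∕ K2-LIT, h413 = `stmt-HodgeConjecture-24833`,
line `K2_E1_TraceFormulaBeta`, 5Res ROADCARD AMENDMENT #3 rung G9 (dealer K2E1-plan (g7) (282)): the SELF-DUAL BLOCK ISOMETRY (Plancherel form) at rank `> 1` in COORDINATE CURRENCY —
the operator letters of ★ `exists_linearIsometry_selfDual_of_pureTensor_letters_sqrt` discharged from the scattering-MATRIX coordinates via ★ p860910 and ★ p860958.
-/
import Summits.HodgeConjecture.HodgeConjecture.Theorems.K2E1ChiSectionPlancherelSelfDualCMTwoExplicit   -- ★ (y1-b) p860798 (K2E4-p10): `exists_linearIsometry_selfDual_of_pureTensor_letters_sqrt`; brings ★ :184, ★ part 4b, parts 1–4a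
import Summits.HodgeConjecture.HodgeConjecture.Theorems.K2E1ChiScatteringMatrixAxisNoPoleU2             -- ★ p860958 (this seat): `hcont_of_mfe_of_ka`; brings ★ p860910 `hs∕hB∕hr∕hRsymm∕hFE∕hadj_of_coords`
import HarnessLib

/-!
# G9 — `K2E1ChiSectionPlancherelFormMatrixU2`: the SELF-DUAL BLOCK ISOMETRY `U(Σ_a θ_{f_{i,a}⊗φ_a}) = (r_i, √(C∕2π)•w_i)` on `(⊕_{c∈S} W) ⊕₂ L²((0,∞); W)` at rank `dim W > 1`, with
# EVERY operator letter read off the scattering-MATRIX COORDINATES `m_z(c,a)` — the coordinate-currency edition of ★ `exists_linearIsometry_selfDual_of_pureTensor_letters_sqrt`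

Track B ∕ K2-LIT, crux h413 = `stmt-HodgeConjecture-24833`, route of record `HCCMUnconditional`; cell `hodgecm-mathlib`, squad K2, ENGINE E1; AMENDMENT #3 «GENERAL (U,τ) LADDER» rung G9
(the analytic input of the self-dual `hU` at `dim V(χ,K′,ω) > 1`, consumer ★ `K2E1SelfDualModelHeckeIntertwining.hU_selfDual_of_generators`).  THEOREMS ONLY (no `def`, no `instance`,
no `notation`, no named-fact hypothesis, no `sorry`; default heartbeats); lane `--supports stmt-HodgeConjecture-24833 --as helper` (count-neutral).  GENERIC: `E` a complex inner-product
space and `v : α → E` a finite linearly independent family (E1: `v_a = [φ_a|_{K_U}] ∈ L²(K_U, μ_K)`, `(φ_a)` a basis of `V(χ, K′, ω)`, `χ` self-dual), `W := span {v_a}`; `H` a complex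
inner-product space (E1: `L²(X, μ)`) with the pure-tensor classes `y_{i,a}` (E1: `[θ_{f_{i,a}, φ_a}]`).
THE MATHEMATICS ([MoeglinWaldspurger1995, II.1.8, II.2.1–II.2.4, IV.1.10–IV.1.11, IV.3.12]; [Langlands1976, §7]).  The rank-`> 1` contour shift and Plancherel form are ★ on OPERATOR
letters: ★ part 2 `K2E1PseudoEisensteinContourShiftVector`, ★ part 4b `exists_linearIsometry_selfDual_of_letters`, ★ :184 `exists_linearIsometry_selfDual_of_pureTensor_letters`, ★ (y1-b)
`…_sqrt` — letters `hs` (MS continuation of the entries `⟪v_b, M(z)v_a⟫` off the finite real pole set `S`), `hr` (entry residues `R_c`), `hB` (strip bound), `hRsymm`∕`hRpos`, `hFE`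
(`M(1−z)M(z) = 1`), `hadj` (`M(z)* = M(z̄)`), `hcont` (axis continuity), plus the pure-tensor two-term Gram letter `hSD`.  At `dim W > 1` the scattering data ARRIVE AS A MATRIX: coordinates
`M(z)v_a = Σ_c m_z(c,a)v_c` (`m_z(c,a) = qc_{a,c}(z)` of ★ `chiEisenstein_meromorphic_exports_level_cm_two`), residues `R_c v_a = Σ_d ρ_c(d,a)v_d`, the MATRIX functional equation
`Σ_c m_{1−z}(d,c)m_z(c,a) = δ_{da}` and the K-pairing adjointness `Σ_c m_z(c,a)⟪v_b,v_c⟫ = conj(Σ_c m_{z̄}(c,b)⟪v_a,v_c⟫)` (MW II.1.8).  THIS FILE discharges EVERY operator letter from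
that coordinate data — `hs`∕`hB`∕`hr`∕`hRsymm`∕`hFE`∕`hadj` by ★ p860910 (`hs_of_coords`, `hB_of_coords`, `hr_of_coords`, `hRsymm_of_coords`, `hFE_of_coords`, `hadj_of_coords`) and `hcont`
by ★ p860958 `hcont_of_mfe_of_ka` (NO POLE ON THE AXIS: `M(½+it)` unitary, coordinates bounded, removable) — and returns the conclusion of ★ `…_pureTensor_letters_sqrt` BYTE-IDENTICALLY
(`V := ↥(span ℂ (range v))`), so that ★ `hU_selfDual_of_generators` consumes it verbatim.  Remaining letters, all COORDINATE-level with named payers: `hm` (coordinates holomorphic on `U ∖ S`,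
K2E1-p16's `chi_scattering_hs_of_model_level_cm_two_all`), `hmB` (coordinate strip bound, ★ T1-χ∕G5), `hρ`∕`hρsymm` (coordinate residues, (KA) at the poles), `hRpos` (operator positivity,
★ `K2E1PositiveResidueGram…` §2 — not entrywise), `hPcd`∕`hmNF` ((E3)∕(E2) of the exports), `hmFE` (level matrix FE, K2E4-p10 G8 FILE 2), `hKA` ((KA), MW II.1.8), `hSD` (H-χ (SD) two-term
formula, K2E3-p12).
* §1 `entry_bound_of_coord_bound` (one strip constant for all entries from a coordinate bound).
* §2 **`exists_linearIsometry_selfDual_of_coords_sqrt`** — THE HEAD.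
HONEST LABEL: HC_CM is proved only modulo the 7 printed citations (2 remaining named inputs: hLiu418 = `stmt-HodgeConjecture-24832`, h413 = `stmt-HodgeConjecture-24833`) until rung 0
closes; this file asserts no named fact and closes no socket; count-neutral; it is an ASSEMBLY over ★ p860798 ∕ ★ p860910 ∕ ★ p860958 (no new analysis).

## References
* [MoeglinWaldspurger1995] C. Mœglin, J.-L. Waldspurger, *Spectral decomposition and Eisenstein series* (1995), II.1.8, II.2.1–II.2.4, IV.1.10–IV.1.11, IV.3.12.
* [Langlands1976] R. P. Langlands, *On the Functional Equations Satisfied by Eisenstein Series*, LNM 544 (1976), §7.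
-/

set_option autoImplicit false
set_option linter.dupNamespace false  -- the mandated namespace repeats the summit's segment (`HodgeConjecture.HodgeConjecture`)

noncomputable section

open MeasureTheory Measure Set Filter Topology Complex
open scoped Real ComplexConjugate InnerProductSpace BigOperators
open Summit.HodgeConjecture.HodgeConjecture.Cruxes.H413.K2E1PlancherelIsometryOfForm (mem_topologicalClosure_span)
open Summit.HodgeConjecture.HodgeConjecture.Cruxes.H413.K2E1ChiSectionPlancherelSelfDualCMTwo (finiteDimensional_span_range)
open Summit.HodgeConjecture.HodgeConjecture.Cruxes.H413.K2E1ChiSectionPlancherelSelfDualCMTwoExplicit (exists_linearIsometry_selfDual_of_pureTensor_letters_sqrt)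
open Summit.HodgeConjecture.HodgeConjecture.Cruxes.H413.K2E1SpanOperatorMatrixLetters (hs_of_coords hB_of_coords hr_of_coords hRsymm_of_coords hFE_of_coords hadj_of_coords)
open Summit.HodgeConjecture.HodgeConjecture.Cruxes.H413.K2E1ChiScatteringMatrixAxisNoPoleU2 (hcont_of_mfe_of_ka)

namespace Summit.HodgeConjecture.HodgeConjecture.Cruxes.H413.K2E1ChiSectionPlancherelFormMatrixU2

variable {E : Type*} [NormedAddCommGroup E] [InnerProductSpace ℂ E] {H : Type*} [NormedAddCommGroup H] [InnerProductSpace ℂ H]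
  {ι α : Type*} [Fintype α] [DecidableEq α] {v : α → E}

/-! ## §1 One strip constant for all entries from a coordinate bound -/

omit [DecidableEq α] in
/-- **ENTRY STRIP BOUND FROM A COORDINATE STRIP BOUND, ONE CONSTANT FOR ALL ENTRIES**: `‖m_z(c,a)‖ ≤ B` on a region ⟹ `‖⟪v_b, M(z)v_a⟫‖ ≤ max B 0 · Σ_{b′} Σ_c ‖⟪v_{b′}, v_c⟫‖` there
(★ `hB_of_coords` and `single ≤ sum`). [cite: MoeglinWaldspurger1995, IV.1.11] -/
theorem entry_bound_of_coord_bound {M : ℂ → ↥(Submodule.span ℂ (Set.range v)) →ₗ[ℂ] ↥(Submodule.span ℂ (Set.range v))} {m : ℂ → α → α → ℂ}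
    (hM : ∀ z a, M z ⟨v a, Submodule.subset_span ⟨a, rfl⟩⟩ = ∑ c, m z c a • (⟨v c, Submodule.subset_span ⟨c, rfl⟩⟩ : ↥(Submodule.span ℂ (Set.range v)))) {p : ℂ → Prop} {B : ℝ}
    (hmB : ∀ c a z, p z → ‖m z c a‖ ≤ B) (a b : α) (z : ℂ) (hz : p z) :
    ‖⟪(⟨v b, Submodule.subset_span ⟨b, rfl⟩⟩ : ↥(Submodule.span ℂ (Set.range v))), M z ⟨v a, Submodule.subset_span ⟨a, rfl⟩⟩⟫_ℂ‖ ≤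
      max B 0 * ∑ b' : α, ∑ c, ‖⟪(⟨v b', Submodule.subset_span ⟨b', rfl⟩⟩ : ↥(Submodule.span ℂ (Set.range v))), ⟨v c, Submodule.subset_span ⟨c, rfl⟩⟩⟫_ℂ‖ := by
  have h1 := hB_of_coords (v := v) hM (p := p) (B := max B 0) (fun c a z hz => (hmB c a z hz).trans (le_max_left _ _)) a b z hz
  refine h1.trans (mul_le_mul_of_nonneg_left ?_ (le_max_right _ _))
  exact Finset.single_le_sum (f := fun b' : α => ∑ c, ‖⟪(⟨v b', Submodule.subset_span ⟨b', rfl⟩⟩ : ↥(Submodule.span ℂ (Set.range v))), ⟨v c, Submodule.subset_span ⟨c, rfl⟩⟩⟫_ℂ‖)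
    (fun b' _ => Finset.sum_nonneg fun c _ => norm_nonneg _) (Finset.mem_univ b)

/-! ## §2 The self-dual block isometry from coordinate data -/

/-- **THE SELF-DUAL BLOCK ISOMETRY AT RANK `> 1` FROM COORDINATE DATA** (coordinate-currency edition of ★ `exists_linearIsometry_selfDual_of_pureTensor_letters_sqrt`, same conclusion with
`V := W = span {v_a}`).  Data: `v` linearly independent; `M(z)`, `R_c ∈ End W` with coordinates `M(z)v_a = Σ_c m_z(c,a)v_c`, `R_c v_a = Σ_d ρ_c(d,a)v_d`; test functions `f_{i,a} ∈ C²_c((0,∞))`;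
classes `y_{i,a} ∈ H`.  Letters (all coordinate-level except `hRpos`, `hSD`): `hUo hUs hS` and **`hm`** (every coordinate holomorphic on `U ∖ S`), **`hρ`** (coordinate simple poles at `S`),
**`hmB`** (coordinate strip bound), **`hρsymm`** (coordinate symmetry of the residues), `hRpos`, **`hPcd`**, **`hmNF`** (coordinates meromorphic in normal form), **`hmFE`** (matrix functional
equation), **`hKA`** (K-pairing adjointness in coordinates), `hC`, `hSD` (pure-tensor two-term Gram letter).  PROOF: ★ p860910 turns `hm hmB hρ hρsymm hmFE hKA` into `hs hB hr hRsymm hFE hadj`,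
★ p860958 `hcont_of_mfe_of_ka` gives `hcont` (no pole on the axis), then ★ `…_pureTensor_letters_sqrt`.  CONCLUSION: `∃ T r w U` — `T_c = R_c^{1/2}` (`T_c(T_c u) = R_c u`, symmetric,
non-negative), `r_i c = √C • T_c Ψ̂_i(−c)`, `⟪r_i, r_j⟫ = C·Σ_c ⟪Ψ̂_i(−c), R_c Ψ̂_j(−c)⟫`, `w_i =ᵐ Ψ̂_i(−(½+it)) + M(½−it)Ψ̂_i(−(½−it))`, `U(Σ_a y_{i,a}) = (r_i, √(C∕2π)•w_i)`.
[cite: MoeglinWaldspurger1995, II.2.4, IV.1.11, IV.3.12] [cite: Langlands1976, §7] -/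
theorem exists_linearIsometry_selfDual_of_coords_sqrt (hv : LinearIndependent ℂ v)
    (y : ι → α → H) {f : ι → α → ℝ → ℂ}
    (hf : ∀ i a, ContDiff ℝ 2 (f i a)) (hfs : ∀ i a, HasCompactSupport (f i a)) (hf0 : ∀ i a, tsupport (f i a) ⊆ Ioi 0)
    (M : ℂ → ↥(Submodule.span ℂ (Set.range v)) →ₗ[ℂ] ↥(Submodule.span ℂ (Set.range v))) {m : ℂ → α → α → ℂ}
    (hM : ∀ z a, M z ⟨v a, Submodule.subset_span ⟨a, rfl⟩⟩ = ∑ c, m z c a • (⟨v c, Submodule.subset_span ⟨c, rfl⟩⟩ : ↥(Submodule.span ℂ (Set.range v))))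
    (R : ℝ → ↥(Submodule.span ℂ (Set.range v)) →ₗ[ℂ] ↥(Submodule.span ℂ (Set.range v))) {ρ : ℝ → α → α → ℂ}
    (hR : ∀ c a, R c ⟨v a, Submodule.subset_span ⟨a, rfl⟩⟩ = ∑ d, ρ c d a • (⟨v d, Submodule.subset_span ⟨d, rfl⟩⟩ : ↥(Submodule.span ℂ (Set.range v))))
    {σ₀ : ℝ} (hσ₀ : 1 / 2 < σ₀) {U : Set ℂ} (hUo : IsOpen U) (hUs : {z : ℂ | 1 / 2 ≤ z.re ∧ z.re ≤ σ₀} ⊆ U) (S : Finset ℝ) (hS : ∀ c ∈ S, 1 / 2 < c ∧ c < σ₀)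
    -- the coordinate MS letters: holomorphy off `S`, simple poles at `S` with residues `ρ`, strip bound, residue symmetry
    (hm : ∀ c a, DifferentiableOn ℂ (fun z => m z c a) (U \ ((S.image fun c : ℝ => (c : ℂ)) : Set ℂ)))
    (hρ : ∀ d a, ∀ c ∈ S, Tendsto (fun z : ℂ => (z - c) * m z d a) (𝓝[≠] (c : ℂ)) (𝓝 (ρ c d a)))
    {B : ℝ} (hmB : ∀ c a (z : ℂ), 1 / 2 < z.re → z.re ≤ σ₀ → 1 ≤ |z.im| → ‖m z c a‖ ≤ B)
    (hρsymm : ∀ c ∈ S, ∀ a b,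
      ∑ d, ρ c d a * ⟪(⟨v b, Submodule.subset_span ⟨b, rfl⟩⟩ : ↥(Submodule.span ℂ (Set.range v))), ⟨v d, Submodule.subset_span ⟨d, rfl⟩⟩⟫_ℂ =
        conj (∑ d, ρ c d b * ⟪(⟨v a, Submodule.subset_span ⟨a, rfl⟩⟩ : ↥(Submodule.span ℂ (Set.range v))), ⟨v d, Submodule.subset_span ⟨d, rfl⟩⟩⟫_ℂ))
    (hRpos : ∀ c ∈ S, ∀ u : ↥(Submodule.span ℂ (Set.range v)), 0 ≤ RCLike.re ⟪u, R c u⟫_ℂ)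
    -- the axis ∕ FE ∕ adjointness letters in coordinates (★ p860958 currency)
    {P : Set ℂ} (hPcd : ∀ z₀ : ℂ, ∀ᶠ w in 𝓝[≠] z₀, w ∉ P) (hmNF : ∀ c a, MeromorphicNFOn (fun z => m z c a) univ)
    (hmFE : ∀ z : ℂ, z ∉ P → 1 - z ∉ P → ∀ d a, ∑ c, m (1 - z) d c * m z c a = if d = a then 1 else 0)
    (hKA : ∀ z : ℂ, z ∉ P → conj z ∉ P → ∀ a b,
      ∑ c, m z c a * ⟪(⟨v b, Submodule.subset_span ⟨b, rfl⟩⟩ : ↥(Submodule.span ℂ (Set.range v))), ⟨v c, Submodule.subset_span ⟨c, rfl⟩⟩⟫_ℂ =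
        conj (∑ c, m (conj z) c b * ⟪(⟨v a, Submodule.subset_span ⟨a, rfl⟩⟩ : ↥(Submodule.span ℂ (Set.range v))), ⟨v c, Submodule.subset_span ⟨c, rfl⟩⟩⟫_ℂ))
    -- the pure-tensor two-term Gram letter on `Re z = σ₀`
    {C : ℝ} (hC : 0 ≤ C)
    (hSD : ∀ i j a b, ⟪y i b, y j a⟫_ℂ = (C : ℂ) * ((((2 * π)⁻¹ : ℝ) : ℂ) * ∫ t : ℝ, mellin (f j a) (-((σ₀ : ℂ) + t * I)) *
      (⟪(⟨v b, Submodule.subset_span ⟨b, rfl⟩⟩ : ↥(Submodule.span ℂ (Set.range v))), ⟨v a, Submodule.subset_span ⟨a, rfl⟩⟩⟫_ℂ * conj (mellin (f i b) (-(1 - conj ((σ₀ : ℂ) + t * I)))) +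
        ⟪(⟨v b, Submodule.subset_span ⟨b, rfl⟩⟩ : ↥(Submodule.span ℂ (Set.range v))), M ((σ₀ : ℂ) + t * I) ⟨v a, Submodule.subset_span ⟨a, rfl⟩⟩⟫_ℂ *
          conj (mellin (f i b) (-conj ((σ₀ : ℂ) + t * I)))))) :
    ∃ (T : ↥S → ↥(Submodule.span ℂ (Set.range v)) →L[ℂ] ↥(Submodule.span ℂ (Set.range v)))
      (r : ι → PiLp 2 (fun _ : ↥S => ↥(Submodule.span ℂ (Set.range v)))) (w : ι → Lp ↥(Submodule.span ℂ (Set.range v)) 2 ((volume : Measure ℝ).restrict (Ioi 0)))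
      (Uiso : (Submodule.span ℂ (Set.range fun i => ∑ a, y i a)).topologicalClosure →ₗᵢ[ℂ]
        WithLp 2 (PiLp 2 (fun _ : ↥S => ↥(Submodule.span ℂ (Set.range v))) × Lp ↥(Submodule.span ℂ (Set.range v)) 2 ((volume : Measure ℝ).restrict (Ioi 0)))),
      (∀ (c : ↥S) (u : ↥(Submodule.span ℂ (Set.range v))), T c (T c u) = R c u) ∧
      (∀ (c : ↥S) (u u' : ↥(Submodule.span ℂ (Set.range v))), ⟪u, T c u'⟫_ℂ = ⟪T c u, u'⟫_ℂ) ∧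
      (∀ (c : ↥S) (u : ↥(Submodule.span ℂ (Set.range v))), 0 ≤ RCLike.re ⟪u, T c u⟫_ℂ) ∧
      (∀ i (c : ↥S), r i c = ((Real.sqrt C : ℝ) : ℂ) • T c (∑ a, mellin (f i a) (-((c : ℝ) : ℂ)) • (⟨v a, Submodule.subset_span ⟨a, rfl⟩⟩ : ↥(Submodule.span ℂ (Set.range v))))) ∧
      (∀ i j, ⟪r i, r j⟫_ℂ = (C : ℂ) * ∑ c ∈ S, ⟪∑ b, mellin (f i b) (-(c : ℂ)) • (⟨v b, Submodule.subset_span ⟨b, rfl⟩⟩ : ↥(Submodule.span ℂ (Set.range v))),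
        R c (∑ a, mellin (f j a) (-(c : ℂ)) • (⟨v a, Submodule.subset_span ⟨a, rfl⟩⟩ : ↥(Submodule.span ℂ (Set.range v))))⟫_ℂ) ∧
      (∀ i, (w i : ℝ → ↥(Submodule.span ℂ (Set.range v))) =ᵐ[(volume : Measure ℝ).restrict (Ioi 0)] fun t =>
        (∑ a, mellin (f i a) (-((((1 / 2 : ℝ)) : ℂ) + t * I)) • (⟨v a, Submodule.subset_span ⟨a, rfl⟩⟩ : ↥(Submodule.span ℂ (Set.range v)))) +
          M ((((1 / 2 : ℝ)) : ℂ) + ((-t : ℝ) : ℂ) * I) (∑ a, mellin (f i a) (-((((1 / 2 : ℝ)) : ℂ) + ((-t : ℝ) : ℂ) * I)) • (⟨v a, Submodule.subset_span ⟨a, rfl⟩⟩ : ↥(Submodule.span ℂ (Set.range v))))) ∧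
      (∀ i, Uiso ⟨∑ a, y i a, mem_topologicalClosure_span (fun i => ∑ a, y i a) i⟩ = WithLp.toLp 2 (r i, ((Real.sqrt (C * (2 * π)⁻¹) : ℝ) : ℂ) • w i)) := by
  haveI : FiniteDimensional ℂ ↥(Submodule.span ℂ (Set.range v)) := finiteDimensional_span_range v
  -- the operator letters from the coordinate data (★ p860910) and the axis continuity (★ p860958)
  have hs := fun a b => hs_of_coords (v := v) hM hm a b
  have hr := hr_of_coords (v := v) hM hR (S := S) hρ
  have hB := fun a b z (h1 : 1 / 2 < z.re) (h2 : z.re ≤ σ₀) (h3 : 1 ≤ |z.im|) =>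
    entry_bound_of_coord_bound (v := v) hM (p := fun z : ℂ => 1 / 2 < z.re ∧ z.re ≤ σ₀ ∧ 1 ≤ |z.im|) (fun c a z hz => hmB c a z hz.1 hz.2.1 hz.2.2) a b z ⟨h1, h2, h3⟩
  have hRsymm := hRsymm_of_coords hv hR (S := S) hρsymm
  have hFE := hFE_of_coords hv hM hmFE
  have hadj := hadj_of_coords hv hM hKA
  have hcont := hcont_of_mfe_of_ka hv hM hPcd hmNF hmFE hKA
  exact exists_linearIsometry_selfDual_of_pureTensor_letters_sqrt y hf hfs hf0 (fun a => (⟨v a, Submodule.subset_span ⟨a, rfl⟩⟩ : ↥(Submodule.span ℂ (Set.range v)))) M hσ₀ hUo hUs S hS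
    hs R hr hB hRsymm hRpos hPcd hFE hadj hcont hC hSD

end Summit.HodgeConjecture.HodgeConjecture.Cruxes.H413.K2E1ChiSectionPlancherelFormMatrixU2

end
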